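import Summits.RiemannHypothesis.RiemannHypothesis.Theorems.Splittings.BombieriTruncSynthesisScreening

/-!
# Splittings — x-wuc (xiv-d5): rows X-6 / X-6∨ / X-6s modulo ⟨`Corollary11Prov`, Littlewood's gap fact⟩ — the bookkeeping of card §13/§13f

Cell rh-split, seat rh-split-x-wuc g6/g7 (brief sha16 f79c5f09d8bcb036), card `run/shared/lean/pub/rh-split/cards/SPLIT-x-wuc.md`
§12–§13 (scratch of record `HOME/rh-split-x-wuc/SplitXWucG7b.lean` sha16 d0583c86bc2d8ec7: farm `lean check` rc 0 · 0 sorry · 0 warning,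
standard axioms; referee replays: see the card).  Carved VERBATIM from that scratch by `HOME/rh-split-x-wuc/cut7/make_cut7.py`
(cut (xiv-d), deltas listed in `cut7/CUT7.md`); sections as numbered there.
* G7.7 the rows with `ZeroOrdinateGapsShrink` and `NearLatticeSynthesis` in hypothesis position (g7 forms); G7b.7 the same rows with PA
  discharged (`synthesisScreening_of_gaps`, `…_g7b`); rows OF RECORD `rh_iff_offLineBoundedMult_and_boundedAway_prov (h5 : Corollary11Prov)
  (hL : littlewood_zero_ordinate_gaps_shrink) : RH ↔ BM_off ∧ B′([−1,1])` and `not_boundedAway_of_obm_of_not_foz_prov`.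
  LABEL: CONDITIONAL bookkeeping (two print facts in hypothesis position); RH-equivalence typing, certifies nothing about RH.
HONEST LABEL: «SPLITTING SEARCH over kernel-typed RH-EQUIVALENCES; a splitting A ∧ B ⟹ RH is CONDITIONAL bookkeeping
unless A and B are both proved; nothing here bears on the truth of RH.»
-/

set_option linter.dupNamespace false

noncomputable section

open scoped Classical ComplexConjugate
open Set Filter Topology Complex MeasureTheory

namespace Summit.RiemannHypothesis.RiemannHypothesis.Theorems.Splittings.BombieriTruncSynthesisRows

open Literature.NumberTheory.LFunctions Literature.NumberTheory.LFunctions.Bombieri2000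
open Summit.RiemannHypothesis.RiemannHypothesis.Theses.RuelleBand
open Summit.RiemannHypothesis.RiemannHypothesis.Theorems.Splittings.BombieriTruncEigen
open Summit.RiemannHypothesis.RiemannHypothesis.Theorems.Splittings.BombieriFozNoDep
open Summit.RiemannHypothesis.RiemannHypothesis.Theorems.Splittings.BombieriTruncGram
open Summit.RiemannHypothesis.RiemannHypothesis.Theorems.Splittings.BombieriTruncPairing
open Summit.RiemannHypothesis.RiemannHypothesis.Theorems.Splittings.BombieriTruncScreening
open Summit.RiemannHypothesis.RiemannHypothesis.Theorems.Splittings.BombieriTruncBandGap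
open Summit.RiemannHypothesis.RiemannHypothesis.Theorems.Splittings.BombieriTruncMultiplicity
open Summit.RiemannHypothesis.RiemannHypothesis.Theorems.Splittings.BombieriTruncEventualStrip
open Summit.RiemannHypothesis.RiemannHypothesis.Theorems.Splittings.BombieriTruncExactness
open Summit.RiemannHypothesis.RiemannHypothesis.Theorems.Splittings.BombieriTruncClump
open Summit.RiemannHypothesis.RiemannHypothesis.Theorems.Splittings.BombieriTruncOffLineSparse
open Summit.RiemannHypothesis.RiemannHypothesis.Theorems.Splittings.BombieriTruncSynthesis
open Summit.RiemannHypothesis.RiemannHypothesis.Theorems.Splittings.BombieriTruncSynthesisScreening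

variable {N : ℕ}

/-! ### G7.7 Row X-6 restated modulo (C5 print, D5′ print, PA ζ-free) -/

open Summit.RiemannHypothesis.RiemannHypothesis.Theorems.Splittings.BombieriCorollaryProvenance in
/-- **Row X-6 (g7 form):** `RH ⟺ BM_off ∧ B′([−1,1])` modulo `Corollary11Prov` [print: Bombieri 2000 Thm 11/Cor.],
`ZeroOrdinateGapsShrink` [print: Littlewood 1924 / Titchmarsh Thm 9.12] and `NearLatticeSynthesis` [ζ-free, elementary, not kernel].
[new-combination; CONDITIONAL bookkeeping] -/
theorem rh_iff_offLineBoundedMult_and_boundedAway_g7 (h5 : Corollary11Prov) (hgap : ZeroOrdinateGapsShrink)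
    (hPA : NearLatticeSynthesis) :
    _root_.RiemannHypothesis ↔ OffLineBoundedMult ∧ TruncNegEigenvalueBoundedAway (Icc (-1 : ℝ) 1) :=
  rh_iff_offLineBoundedMult_and_boundedAway h5 (synthesisScreening_of hgap hPA)

open Summit.RiemannHypothesis.RiemannHypothesis.Theorems.Splittings.BombieriCorollaryProvenance in
/-- **Row X-6∨ (g7 form):** `RH ⟺ (ES_m ∨ BM_off) ∧ B′([−1,1])` modulo the same three hypotheses. -/
theorem rh_iff_esm_or_obm_and_boundedAway_g7 (h5 : Corollary11Prov) (hgap : ZeroOrdinateGapsShrink)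
    (hPA : NearLatticeSynthesis) :
    _root_.RiemannHypothesis ↔
      (EventualStripMult ∨ OffLineBoundedMult) ∧ TruncNegEigenvalueBoundedAway (Icc (-1 : ℝ) 1) :=
  rh_iff_esm_or_obm_and_boundedAway h5 (synthesisScreening_of hgap hPA)

open Summit.RiemannHypothesis.RiemannHypothesis.Theorems.Splittings.BombieriCorollaryProvenance in
/-- **Row X-6s (g7 form):** given `M`-bounded OFF-LINE multiplicities, `B′([−1,1]) ⟺ RH` modulo the three hypotheses. -/
theorem boundedAway_one_iff_rh_of_offLineBoundedMult_g7 (h5 : Corollary11Prov) (hgap : ZeroOrdinateGapsShrink)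
    (hPA : NearLatticeSynthesis) (hBM : OffLineBoundedMult) :
    TruncNegEigenvalueBoundedAway (Icc (-1 : ℝ) 1) ↔ _root_.RiemannHypothesis :=
  boundedAway_one_iff_rh_of_offLineBoundedMult h5 (synthesisScreening_of hgap hPA) hBM

/-- **The FOZ-free kernel content of X-6 (g7):** `BM_off ∧ ¬FOZ ∧ D5′ ∧ PA ⟹ ¬B′([−1,1])` — no `Corollary11Prov`, no RH. -/
theorem not_boundedAway_of_obm_of_not_foz (hgap : ZeroOrdinateGapsShrink) (hPA : NearLatticeSynthesis)
    (hBM : OffLineBoundedMult) (hnotfoz : ¬ CofiniteCriticalLine) :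
    ¬ TruncNegEigenvalueBoundedAway (Icc (-1 : ℝ) 1) :=
  synthesisScreening_of hgap hPA hBM hnotfoz

/-! ### G7b.7 Consequences: T7 and Row X-6 with the ζ-free input discharged (PA = `nearLatticeSynthesis`, module d4) -/

/-- **T7 (g7b form):** `SynthesisScreening` from the qualitative Littlewood gap theorem alone. -/
theorem synthesisScreening_of_gaps (hgap : ZeroOrdinateGapsShrink) : SynthesisScreening :=
  synthesisScreening_of hgap nearLatticeSynthesis

open Summit.RiemannHypothesis.RiemannHypothesis.Theorems.Splittings.BombieriCorollaryProvenance in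
/-- **Row X-6 (g7b form):** `RH ⟺ BM_off ∧ B′([−1,1])` modulo `Corollary11Prov` [print: Bombieri 2000 Thm 11/Cor.] and
`ZeroOrdinateGapsShrink` [print: Littlewood 1924 / Titchmarsh Thm 9.12]. [new-combination; CONDITIONAL bookkeeping] -/
theorem rh_iff_offLineBoundedMult_and_boundedAway_g7b (h5 : Corollary11Prov) (hgap : ZeroOrdinateGapsShrink) :
    _root_.RiemannHypothesis ↔ OffLineBoundedMult ∧ TruncNegEigenvalueBoundedAway (Icc (-1 : ℝ) 1) :=
  rh_iff_offLineBoundedMult_and_boundedAway_g7 h5 hgap nearLatticeSynthesis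

open Summit.RiemannHypothesis.RiemannHypothesis.Theorems.Splittings.BombieriCorollaryProvenance in
/-- **Row X-6∨ (g7b form):** `RH ⟺ (ES_m ∨ BM_off) ∧ B′([−1,1])` modulo the same two print hypotheses. -/
theorem rh_iff_esm_or_obm_and_boundedAway_g7b (h5 : Corollary11Prov) (hgap : ZeroOrdinateGapsShrink) :
    _root_.RiemannHypothesis ↔
      (EventualStripMult ∨ OffLineBoundedMult) ∧ TruncNegEigenvalueBoundedAway (Icc (-1 : ℝ) 1) :=
  rh_iff_esm_or_obm_and_boundedAway_g7 h5 hgap nearLatticeSynthesis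

open Summit.RiemannHypothesis.RiemannHypothesis.Theorems.Splittings.BombieriCorollaryProvenance in
/-- **Row X-6s (g7b form):** given `M`-bounded OFF-LINE multiplicities, `B′([−1,1]) ⟺ RH` modulo the two print hypotheses. -/
theorem boundedAway_one_iff_rh_of_offLineBoundedMult_g7b (h5 : Corollary11Prov) (hgap : ZeroOrdinateGapsShrink)
    (hBM : OffLineBoundedMult) :
    TruncNegEigenvalueBoundedAway (Icc (-1 : ℝ) 1) ↔ _root_.RiemannHypothesis :=
  boundedAway_one_iff_rh_of_offLineBoundedMult_g7 h5 hgap nearLatticeSynthesis hBM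

/-- **The FOZ-free kernel content of X-6 (g7b):** `BM_off ∧ ¬FOZ ∧ ZeroOrdinateGapsShrink ⟹ ¬B′([−1,1])` —
no `Corollary11Prov`, no RH; the only non-kernel input is the Littlewood gap theorem (print). -/
theorem not_boundedAway_of_obm_of_not_foz_g7b (hgap : ZeroOrdinateGapsShrink)
    (hBM : OffLineBoundedMult) (hnotfoz : ¬ CofiniteCriticalLine) :
    ¬ TruncNegEigenvalueBoundedAway (Icc (-1 : ℝ) 1) :=
  not_boundedAway_of_obm_of_not_foz hgap nearLatticeSynthesis hBM hnotfoz

/-! ### Rows of record modulo the tree's named print facts ONLY (`Corollary11Prov`, `littlewood_zero_ordinate_gaps_shrink`) -/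

open Summit.RiemannHypothesis.RiemannHypothesis.Theorems.Splittings.BombieriCorollaryProvenance in
/-- **Row X-6 (of record):** `RH ⟺ BM_off ∧ B′([−1,1])` modulo the two PRINT named facts `Corollary11Prov` [Bombieri 2000] and
`littlewood_zero_ordinate_gaps_shrink` [cite: Titchmarsh1986, Thm 9.12], both hypothesis-only.  LABEL: class-(a) CONDITIONAL
BOOKKEEPING at the standing of row C5 plus one classical theorem; both conjuncts RH-implied and open; not a survivor. -/
theorem rh_iff_offLineBoundedMult_and_boundedAway_prov (h5 : Corollary11Prov)
    (hL : Literature.NumberTheory.LFunctions.littlewood_zero_ordinate_gaps_shrink) :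
    _root_.RiemannHypothesis ↔ OffLineBoundedMult ∧ TruncNegEigenvalueBoundedAway (Icc (-1 : ℝ) 1) :=
  rh_iff_offLineBoundedMult_and_boundedAway_g7b h5 (zeroOrdinateGapsShrink_of_littlewood hL)

/-- **FOZ-free content of X-6 (of record):** `BM_off ∧ ¬FOZ ⟹ ¬B′([−1,1])` modulo Littlewood's gap fact only (no C5, no RH). -/
theorem not_boundedAway_of_obm_of_not_foz_prov
    (hL : Literature.NumberTheory.LFunctions.littlewood_zero_ordinate_gaps_shrink)
    (hBM : OffLineBoundedMult) (hnotfoz : ¬ CofiniteCriticalLine) :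
    ¬ TruncNegEigenvalueBoundedAway (Icc (-1 : ℝ) 1) :=
  not_boundedAway_of_obm_of_not_foz_g7b (zeroOrdinateGapsShrink_of_littlewood hL) hBM hnotfoz

end Summit.RiemannHypothesis.RiemannHypothesis.Theorems.Splittings.BombieriTruncSynthesisRows
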